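import Mathlib
import Summits.ResolutionOfSingularities.ResolutionOfSingularities.Theorems.HomologicalConductorPersistenceFaithfullyFlatDescent
import HarnessLib

set_option linter.dupNamespace false

/-!
# Pointwise flat descent of cohomology annihilators; cylinders `W × 𝔸ᵐ` (KILL LOGIC (3))

`[OURS · L w44b · crux HomologicalConductor.Persistence (stmt-ResolutionOfSingularities-16484) ·
K-E8 / K-E6 kill logic (3), res-L1-w44b-plan-1 2026-08-27T10:37:31Z · res-type-015 gen 16]` — helper,
`--supports stmt-ResolutionOfSingularities-16484 --as helper`.  NOT a statement of the manuscript under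
adjudication in cell res-hironaka; pure commutative algebra over Mathlib and the tree's
`Literature.RingTheory.CohomologyAnnihilator` library.  AI-written, weaker than expert review.

(D4) **Pointwise descent along flat algebras.** For a FLAT algebra `B` over a noetherian ring `A`
(`B` noetherian) and a prime `𝔓` of `B` over `𝔭 = 𝔓 ∩ A`, the local map `A_𝔭 → B_𝔓` is flat and
local, hence faithfully flat, so by (D2)/(D3) of `…PersistenceFaithfullyFlatDescent` (p509146)
`caⁿ⁺¹(B_𝔓) ∩ A_𝔭 ⊆ caⁿ⁺¹(A_𝔭)` and `ca(B_𝔓) ∩ A_𝔭 ⊆ ca(A_𝔭)`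
(`comap_cohomologyAnnihilatorOfDegree_succ_le_atPrime`, `comap_cohomologyAnnihilator_le_atPrime`;
elementwise forms `algebraMap_mem_…_of_liesOver` with Mathlib's canonical algebra
`Localization.AtPrime.algebraOfLiesOver`).

**Cylinders.** With `B = A[X]` (free, hence flat) this is the planner's KILL LOGIC (3) for every
«surface × line» stage at once: for `c ∈ W` and ANY prime `𝔐` of `W[X]` over a prime `v` of `W`
(e.g. the closed point `(v, X = u₀)` of `W × 𝔸¹`),
`c ∈ caⁿ⁺¹((W[X])_𝔐) ⇒ c ∈ caⁿ⁺¹(W_v)` (`C_mem_cohomologyAnnihilatorOfDegree_succ_of_polynomial`),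
`c ∈ ca((W[X])_𝔐) ⇒ c ∈ ca(W_v)` (`C_mem_cohomologyAnnihilator_of_polynomial`), and contrapositively a
LOST certificate at the surface point (`c ∉ ca(W_v)`) is a LOST certificate at the cylinder point
(`C_not_mem_cohomologyAnnihilator_of_polynomial`; level-wise `∀ n` form
`C_forall_not_mem_cohomologyAnnihilatorOfDegree_of_polynomial`) — no further transfer lemma is needed between a
non-membership computed on `W` and the refutation of `Persistence` at the stage `(W × line)_𝔐`.
The same for `W × 𝔸ᵐ` (`MvPolynomial`, finite index type).

References: S. B. Iyengar, R. Takahashi, arXiv:1404.1476 §2 [`IyengarTakahashi2014`] (vocabulary);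
faithfully flat descent is folklore (Mathlib `Module.FaithfullyFlat.of_flat_of_isLocalHom`).
-/

noncomputable section

open Polynomial Literature.RingTheory.CohomologyAnnihilator
open Summit.ResolutionOfSingularities.ResolutionOfSingularities.Theorems.HomologicalConductor.PersistenceFaithfullyFlatDescent

universe u

namespace Summit.ResolutionOfSingularities.ResolutionOfSingularities.Theorems.HomologicalConductor.PersistenceFlatPointwiseDescent

variable {A B : Type u} [CommRing A] [CommRing B] [Algebra A B]

/-! ## (D4) Flat algebras, prime by prime -/

/-- **(D4) `caⁿ⁺¹` descends from `B_𝔓` to `A_𝔭` for a flat noetherian `A`-algebra `B` and a prime `𝔓`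
over `𝔭`** (any `Localization.AtPrime.IsLiesOverAlgebra` structure): `caⁿ⁺¹(B_𝔓) ∩ A_𝔭 ⊆ caⁿ⁺¹(A_𝔭)`.
`A_𝔭 → B_𝔓` is flat (Mathlib) and local (Mathlib), so (D3) applies. [folklore] -/
theorem comap_cohomologyAnnihilatorOfDegree_succ_le_atPrime [IsNoetherianRing A] [IsNoetherianRing B]
    [Module.Flat A B] (p : Ideal A) [p.IsPrime] (P : Ideal B) [P.IsPrime] [P.LiesOver p]
    [Algebra (Localization.AtPrime p) (Localization.AtPrime P)]
    [Localization.AtPrime.IsLiesOverAlgebra p P] (n : ℕ) :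
    (cohomologyAnnihilatorOfDegree (Localization.AtPrime P) (n + 1)).comap
        (algebraMap (Localization.AtPrime p) (Localization.AtPrime P)) ≤
      cohomologyAnnihilatorOfDegree (Localization.AtPrime p) (n + 1) := by
  haveI : IsNoetherianRing (Localization.AtPrime p) :=
    IsLocalization.isNoetherianRing p.primeCompl _ inferInstance
  haveI : IsNoetherianRing (Localization.AtPrime P) :=
    IsLocalization.isNoetherianRing P.primeCompl _ inferInstance
  exact comap_cohomologyAnnihilatorOfDegree_succ_le_of_flat_of_isLocalHom n

/-- **(D4, `ca` form)**: `ca(B_𝔓) ∩ A_𝔭 ⊆ ca(A_𝔭)` for a flat noetherian `A`-algebra `B`, `𝔓` over `𝔭`.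
[folklore] -/
theorem comap_cohomologyAnnihilator_le_atPrime [IsNoetherianRing A] [IsNoetherianRing B]
    [Module.Flat A B] (p : Ideal A) [p.IsPrime] (P : Ideal B) [P.IsPrime] [P.LiesOver p]
    [Algebra (Localization.AtPrime p) (Localization.AtPrime P)]
    [Localization.AtPrime.IsLiesOverAlgebra p P] :
    (cohomologyAnnihilator (Localization.AtPrime P)).comap
        (algebraMap (Localization.AtPrime p) (Localization.AtPrime P)) ≤
      cohomologyAnnihilator (Localization.AtPrime p) := by
  haveI : IsNoetherianRing (Localization.AtPrime p) :=
    IsLocalization.isNoetherianRing p.primeCompl _ inferInstance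
  haveI : IsNoetherianRing (Localization.AtPrime P) :=
    IsLocalization.isNoetherianRing P.primeCompl _ inferInstance
  haveI : Module.FaithfullyFlat (Localization.AtPrime p) (Localization.AtPrime P) :=
    Module.FaithfullyFlat.of_flat_of_isLocalHom
  exact comap_cohomologyAnnihilator_le_of_faithfullyFlat

/-- The two routes `A → A_𝔭 → B_𝔓` and `A → B → B_𝔓` agree (canonical algebra of Mathlib).
[folklore] -/
theorem algebraMap_atPrime_apply (p : Ideal A) [p.IsPrime] (P : Ideal B) [P.IsPrime] [P.LiesOver p]
    [Algebra (Localization.AtPrime p) (Localization.AtPrime P)]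
    [Localization.AtPrime.IsLiesOverAlgebra p P] (x : A) :
    algebraMap (Localization.AtPrime p) (Localization.AtPrime P)
        (algebraMap A (Localization.AtPrime p) x) =
      algebraMap B (Localization.AtPrime P) (algebraMap A B x) := by
  rw [← IsScalarTower.algebraMap_apply A (Localization.AtPrime p) (Localization.AtPrime P),
    IsScalarTower.algebraMap_apply A B (Localization.AtPrime P)]

/-- **(D4, elementwise, canonical algebra)**: for `x ∈ A` with `x ∈ caⁿ⁺¹(B_𝔓)` (image), `x ∈ caⁿ⁺¹(A_𝔭)`
(image) — flat noetherian `B`, `𝔓` over `𝔭`; no algebra structure between the localisations is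
assumed (Mathlib's `algebraOfLiesOver` is installed inside). [folklore] -/
theorem algebraMap_mem_cohomologyAnnihilatorOfDegree_succ_of_liesOver [IsNoetherianRing A]
    [IsNoetherianRing B] [Module.Flat A B] (p : Ideal A) [p.IsPrime] (P : Ideal B) [P.IsPrime]
    [P.LiesOver p] {n : ℕ} {x : A}
    (hx : algebraMap B (Localization.AtPrime P) (algebraMap A B x) ∈
      cohomologyAnnihilatorOfDegree (Localization.AtPrime P) (n + 1)) :
    algebraMap A (Localization.AtPrime p) x ∈
      cohomologyAnnihilatorOfDegree (Localization.AtPrime p) (n + 1) := by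
  letI := Localization.AtPrime.algebraOfLiesOver p P
  refine comap_cohomologyAnnihilatorOfDegree_succ_le_atPrime p P n ?_
  rw [Ideal.mem_comap, algebraMap_atPrime_apply p P x]
  exact hx

/-- **(D4, elementwise, `ca` form)**: `x ∈ ca(B_𝔓)` (image) ⇒ `x ∈ ca(A_𝔭)` (image). [folklore] -/
theorem algebraMap_mem_cohomologyAnnihilator_of_liesOver [IsNoetherianRing A] [IsNoetherianRing B]
    [Module.Flat A B] (p : Ideal A) [p.IsPrime] (P : Ideal B) [P.IsPrime] [P.LiesOver p] {x : A}
    (hx : algebraMap B (Localization.AtPrime P) (algebraMap A B x) ∈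
      cohomologyAnnihilator (Localization.AtPrime P)) :
    algebraMap A (Localization.AtPrime p) x ∈ cohomologyAnnihilator (Localization.AtPrime p) := by
  letI := Localization.AtPrime.algebraOfLiesOver p P
  refine comap_cohomologyAnnihilator_le_atPrime p P ?_
  rw [Ideal.mem_comap, algebraMap_atPrime_apply p P x]
  exact hx

/-- **(D4, contrapositive = transfer of LOST certificates up a flat map)**: if the image of `x` is
NOT in `ca(A_𝔭)` then its image is not in `ca(B_𝔓)`, for every prime `𝔓` of the flat noetherian
`A`-algebra `B` over `𝔭`. [folklore] -/
theorem algebraMap_not_mem_cohomologyAnnihilator_of_liesOver [IsNoetherianRing A] [IsNoetherianRing B]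
    [Module.Flat A B] (p : Ideal A) [p.IsPrime] (P : Ideal B) [P.IsPrime] [P.LiesOver p] {x : A}
    (hx : algebraMap A (Localization.AtPrime p) x ∉ cohomologyAnnihilator (Localization.AtPrime p)) :
    algebraMap B (Localization.AtPrime P) (algebraMap A B x) ∉
      cohomologyAnnihilator (Localization.AtPrime P) :=
  fun h => hx (algebraMap_mem_cohomologyAnnihilator_of_liesOver p P h)

/-- **(D4, all levels)**: if the image of `x` lies in NO `caⁿ(A_𝔭)` then its image lies in no
`caⁿ(B_𝔓)` (`𝔓` over `𝔭`, `B` flat noetherian) — the shape of the §H2L LOST certificates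
(`∀ n, · ∉ caⁿ`). (Level `0` is handled through `ca⁰ ⊆ ca¹`.) [folklore] -/
theorem algebraMap_forall_not_mem_cohomologyAnnihilatorOfDegree_of_liesOver [IsNoetherianRing A]
    [IsNoetherianRing B] [Module.Flat A B] (p : Ideal A) [p.IsPrime] (P : Ideal B) [P.IsPrime]
    [P.LiesOver p] {x : A}
    (hx : ∀ n : ℕ, algebraMap A (Localization.AtPrime p) x ∉
      cohomologyAnnihilatorOfDegree (Localization.AtPrime p) n) (n : ℕ) :
    algebraMap B (Localization.AtPrime P) (algebraMap A B x) ∉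
      cohomologyAnnihilatorOfDegree (Localization.AtPrime P) n := by
  intro h
  have h' : algebraMap B (Localization.AtPrime P) (algebraMap A B x) ∈
      cohomologyAnnihilatorOfDegree (Localization.AtPrime P) (n + 1) :=
    cohomologyAnnihilatorOfDegree_mono (Nat.le_succ n) h
  exact hx (n + 1) (algebraMap_mem_cohomologyAnnihilatorOfDegree_succ_of_liesOver p P h')

/-! ## Cylinders `W × 𝔸¹`: KILL LOGIC (3) -/

/-- **KILL LOGIC (3), graded form**: for a noetherian ring `W`, `c ∈ W`, a prime `v` of `W` and ANY
prime `𝔐` of `W[X]` over `v` (e.g. the point `(v, X = u₀)` of `W × 𝔸¹`):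
`C c ∈ caⁿ⁺¹((W[X])_𝔐) ⇒ c ∈ caⁿ⁺¹(W_v)`. (`W[X]` is free over `W`, hence flat.) [folklore] -/
theorem C_mem_cohomologyAnnihilatorOfDegree_succ_of_polynomial [IsNoetherianRing A] (v : Ideal A)
    [v.IsPrime] (M : Ideal A[X]) [M.IsPrime] [M.LiesOver v] {n : ℕ} {c : A}
    (hc : algebraMap A[X] (Localization.AtPrime M) (C c) ∈
      cohomologyAnnihilatorOfDegree (Localization.AtPrime M) (n + 1)) :
    algebraMap A (Localization.AtPrime v) c ∈
      cohomologyAnnihilatorOfDegree (Localization.AtPrime v) (n + 1) :=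
  algebraMap_mem_cohomologyAnnihilatorOfDegree_succ_of_liesOver v M
    (by rw [← Polynomial.C_eq_algebraMap]; exact hc)

/-- **KILL LOGIC (3), `ca` form**: `C c ∈ ca((W[X])_𝔐) ⇒ c ∈ ca(W_v)` for every prime `𝔐` of `W[X]`
over `v` (`W` noetherian). [folklore] -/
theorem C_mem_cohomologyAnnihilator_of_polynomial [IsNoetherianRing A] (v : Ideal A) [v.IsPrime]
    (M : Ideal A[X]) [M.IsPrime] [M.LiesOver v] {c : A}
    (hc : algebraMap A[X] (Localization.AtPrime M) (C c) ∈
      cohomologyAnnihilator (Localization.AtPrime M)) :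
    algebraMap A (Localization.AtPrime v) c ∈ cohomologyAnnihilator (Localization.AtPrime v) :=
  algebraMap_mem_cohomologyAnnihilator_of_liesOver v M (by rw [← Polynomial.C_eq_algebraMap]; exact hc)

/-- **KILL LOGIC (3), contrapositive (a LOST certificate on the surface IS a LOST certificate on the
cylinder)**: if `c ∉ ca(W_v)` then `C c ∉ ca((W[X])_𝔐)` for EVERY prime `𝔐` of `W[X]` over `v` — so
«`x̄ ∉ ca(W_v)`» refutes persistence at the stage `(W × line)_𝔐` with no further transfer. [folklore] -/
theorem C_not_mem_cohomologyAnnihilator_of_polynomial [IsNoetherianRing A] (v : Ideal A) [v.IsPrime]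
    (M : Ideal A[X]) [M.IsPrime] [M.LiesOver v] {c : A}
    (hc : algebraMap A (Localization.AtPrime v) c ∉ cohomologyAnnihilator (Localization.AtPrime v)) :
    algebraMap A[X] (Localization.AtPrime M) (C c) ∉ cohomologyAnnihilator (Localization.AtPrime M) :=
  fun h => hc (C_mem_cohomologyAnnihilator_of_polynomial v M h)

/-- **KILL LOGIC (3), all levels**: `(∀ n, c ∉ caⁿ(W_v)) ⇒ ∀ n, C c ∉ caⁿ((W[X])_𝔐)` for every prime
`𝔐` of `W[X]` over `v` — a level-wise LOST certificate at the surface point is one at every cylinder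
point above it. [folklore] -/
theorem C_forall_not_mem_cohomologyAnnihilatorOfDegree_of_polynomial [IsNoetherianRing A]
    (v : Ideal A) [v.IsPrime] (M : Ideal A[X]) [M.IsPrime] [M.LiesOver v] {c : A}
    (hc : ∀ n : ℕ, algebraMap A (Localization.AtPrime v) c ∉
      cohomologyAnnihilatorOfDegree (Localization.AtPrime v) n) (n : ℕ) :
    algebraMap A[X] (Localization.AtPrime M) (C c) ∉
      cohomologyAnnihilatorOfDegree (Localization.AtPrime M) n := by
  rw [Polynomial.C_eq_algebraMap]
  exact algebraMap_forall_not_mem_cohomologyAnnihilatorOfDegree_of_liesOver v M hc n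

/-! ## Cylinders `W × 𝔸ᵐ` -/

/-- **`W × 𝔸ᵐ`, graded form**: for a finite index type `σ`, a prime `v` of the noetherian ring `W` and
any prime `𝔐` of `MvPolynomial σ W` over `v`: `C c ∈ caⁿ⁺¹((W[σ])_𝔐) ⇒ c ∈ caⁿ⁺¹(W_v)`. [folklore] -/
theorem mvPolynomial_C_mem_cohomologyAnnihilatorOfDegree_succ [IsNoetherianRing A] {σ : Type u}
    [Finite σ] (v : Ideal A) [v.IsPrime] (M : Ideal (MvPolynomial σ A)) [M.IsPrime] [M.LiesOver v]
    {n : ℕ} {c : A}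
    (hc : algebraMap (MvPolynomial σ A) (Localization.AtPrime M) (MvPolynomial.C c) ∈
      cohomologyAnnihilatorOfDegree (Localization.AtPrime M) (n + 1)) :
    algebraMap A (Localization.AtPrime v) c ∈
      cohomologyAnnihilatorOfDegree (Localization.AtPrime v) (n + 1) :=
  algebraMap_mem_cohomologyAnnihilatorOfDegree_succ_of_liesOver v M
    (by rw [← MvPolynomial.C_eq_algebraMap] ; exact hc)

/-- **`W × 𝔸ᵐ`, `ca` form and contrapositive**: `C c ∈ ca((W[σ])_𝔐) ⇒ c ∈ ca(W_v)`, hence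
`c ∉ ca(W_v) ⇒ C c ∉ ca((W[σ])_𝔐)`. [folklore] -/
theorem mvPolynomial_C_not_mem_cohomologyAnnihilator [IsNoetherianRing A] {σ : Type u} [Finite σ]
    (v : Ideal A) [v.IsPrime] (M : Ideal (MvPolynomial σ A)) [M.IsPrime] [M.LiesOver v] {c : A}
    (hc : algebraMap A (Localization.AtPrime v) c ∉ cohomologyAnnihilator (Localization.AtPrime v)) :
    algebraMap (MvPolynomial σ A) (Localization.AtPrime M) (MvPolynomial.C c) ∉
      cohomologyAnnihilator (Localization.AtPrime M) :=
  fun h => hc (algebraMap_mem_cohomologyAnnihilator_of_liesOver v M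
    (by rw [← MvPolynomial.C_eq_algebraMap]; exact h))

end Summit.ResolutionOfSingularities.ResolutionOfSingularities.Theorems.HomologicalConductor.PersistenceFlatPointwiseDescent

end
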